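import Mathlib
import Summits.Ventures.HodgeRepro.Tier4.Line4.ArchFactorProd
import Summits.Ventures.HodgeRepro.Tier4.Line4.ArchMatchingSeesaw

/-!
# Tier4/Line4/ArchWitnessLeftLaw — C-L4-HF-TORUS, part 1: the LEFT `T′(𝔸)`-law of the branch witness `archWitnessOf`
and the POINTWISE NON-VANISHING CRITERION (`archWitnessOf x ≠ 0 ↔ ∀ w′ ≠ w₀, defCoeff w′ (eP′ w′) (eM′ w′) x ≠ 0`)

Blind re-derivation cell `pub-hodge-repro`, Tier 4 «prove the step» (README §9–§10), seat t4-L4-x2 (extra prover, LINE L4,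
gen 2; the `harch ≠ 0` half of the lead's S15082 (i); self-named cut S16292).  Target tree path
`lean/Summits/Ventures/HodgeRepro/Tier4/Line4/ArchWitnessLeftLaw.lean`.  On L1-p5's ArchFactorProd (p706229: `torusWeight'`,
the RIGHT laws `archWitness(')_mul_torus'`), ArchProdCoeff (p705212: `archProd`, `defCoeffProd`, `d3Gen(')`) with its
per-factor LEFT laws (`D3coeff'_torus'_mul` p700675, `D3coeff''_torus'_mul`, `detTwist_torus'_mul` p704275,
`defCoeff_torus'_mul` p703816) and ArchMatchingSeesaw (p709235: the branch witness `archWitnessOf`); typer-2's LocalUnitary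
(`locEntry_zero_zero_ne_zero`: `|α| ≥ 1` on `U(1,1)`) and L1-p5's D3CoeffDelta (`locEntry_one_one_ne_zero`); no printed input.

WHAT IS PROVED (kernel, no definition).
* **the LEFT `T′(𝔸)`-laws**, the twins of ArchFactorProd's right laws: `d3Gen_torus'_mul`, `d3Gen'_torus'_mul`,
  `defCoeffProd_torus'_mul`, `archWitness_torus'_mul`, `archWitness'_torus'_mul`, and for the branch witness
  **`archWitnessOf_torus'_mul`** (`archWitnessOf (κ x) = Wt(κ) · archWitnessOf x`, `κ ∈ T′(𝔸)`) together with its right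
  twin **`archWitnessOf_mul_torus'`** (the case split `eP′ w₀ = eM′ w₀ + 3 ∨ eM′ w₀ = eP′ w₀ + 3` of ArchMatchingSeesaw);
* **the `w₀`-factor NEVER vanishes**: `locEntry'_zero_zero_ne_zero` (`α′ ≠ 0` on `U(1,1)`), `D3coeff'_ne_zero`,
  `D3coeff''_ne_zero`, `detTwist_ne_zero` (`|det| = 1`), `d3Gen_ne_zero`, `d3Gen'_ne_zero`;
* **the POINTWISE CRITERION** `archWitnessOf_ne_zero_iff`: with the `U(1,1)` signs at `w₀`,
  `archWitnessOf x ≠ 0 ↔ ∀ w′ ≠ w₀, defCoeff w′ (eP′ w′) (eM′ w′) x ≠ 0`, and `defCoeff_ne_zero_iff`: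
  `defCoeff w p m x ≠ 0 ↔ (p = 0 ∨ α′(x) ≠ 0) ∧ (m = 0 ∨ δ′(x) ≠ 0)` — the diagonal entries of the `T′`-adapted
  definite `w`-block of `x` (`wtMono_ne_zero_iff`).

Part 2 (Tier4/Line4/ArchFourierTorus) reads the `hF` integral of display (7a) / the `γ₀`-existence display as a function of
`γ₀` and reduces it, at the identity instance `T ≤ T′`, to a K-type identity and this pointwise criterion.  Nothing here says
anything about the status of the Hodge conjecture for CM abelian varieties, which is NOT proved (HC_CM is NOT proved by
anyone in this repository).
-/

set_option autoImplicit false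

noncomputable section

namespace Summit.Ventures.HodgeRepro.Tier4.Line4

open Summit.Ventures.HodgeRepro.Tier4.Common Summit.Ventures.HodgeRepro.Tier4.Line1 NumberField Matrix MeasureTheory

open scoped ComplexConjugate

open scoped Classical

section Generic

/-- **`wtMono p z ≠ 0 ↔ p = 0 ∨ z ≠ 0`** (`wtMono p z = conj z ^ p₊ · z ^ p₋`). -/
theorem wtMono_ne_zero_iff (p : ℤ) (z : ℂ) : wtMono p z ≠ 0 ↔ p = 0 ∨ z ≠ 0 := by
  unfold wtMono
  rcases lt_trichotomy p 0 with hp | hp | hp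
  · have h1 : p.toNat = 0 := Int.toNat_eq_zero.2 hp.le
    have h2 : (-p).toNat ≠ 0 := by
      rw [Ne, Int.toNat_eq_zero, not_le]
      exact neg_pos.2 hp
    rw [h1, pow_zero, one_mul, Ne, pow_eq_zero_iff h2]
    constructor
    · exact fun h => Or.inr h
    · rintro (h | h)
      · exact absurd h hp.ne
      · exact h
  · subst hp
    simp
  · have h1 : p.toNat ≠ 0 := by
      rw [Ne, Int.toNat_eq_zero, not_le]
      exact hp
    have h2 : (-p).toNat = 0 := Int.toNat_eq_zero.2 (neg_nonpos.2 hp.le)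
    rw [h2, pow_zero, mul_one, Ne, pow_eq_zero_iff h1, map_eq_zero]
    constructor
    · exact fun h => Or.inr h
    · rintro (h | h)
      · exact absurd h hp.ne'
      · exact h

end Generic

section LeftLaws

variable {k : Type} [Field k] [NumberField k] (q : QuadData k) (a : Fin 4 → k)
  (g g' : Matrix (Fin 4) (Fin 4) k) (hgg' : g * g' = 1) (hg'g : g' * g = 1)
  (hgΩ : g * (PlaneData.mixedRow q (a 0) (a 2)).Ω = (PlaneData.mixedRow q (a 0) (a 2)).Ω * g)
  (lam : k) (hlam : lam ≠ 0)
  (hiso : g * (PlaneData.mixedRow q (a 1) (a 3)).B * gᵀ = lam • (PlaneData.mixedRow q (a 0) (a 2)).B)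
  (w₀ : InfinitePlace k) (eP' eM' : InfinitePlace k → ℤ)

include hlam in
/-- **the LEFT `T′(𝔸)`-law of `d3Gen m`**: `d3Gen m (κ x) = u₀(κ)^{−(m + 3)} u₁(κ)^{−m} · d3Gen m x` (the twin of
ArchFactorProd's `d3Gen_mul_torus'`, from the per-factor left laws `D3coeff'_torus'_mul` / `detTwist_torus'_mul`). -/
theorem d3Gen_torus'_mul (hw : w₀.IsReal) (hcm : IsCMAt q w₀) (ha1 : a 1 ≠ 0) (ha3 : a 3 ≠ 0) (m : ℤ)
    (x κ : GA ((PlaneData.mixedRow q (a 0) (a 2)).withTransportedTorus g g' hgg' hg'g hgΩ))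
    (hκ : κ ∈ torusT' ((PlaneData.mixedRow q (a 0) (a 2)).withTransportedTorus g g' hgg' hg'g hgΩ)) :
    d3Gen q a g g' hgg' hg'g hgΩ lam hiso w₀ m (κ * x) =
      weightAt' ((PlaneData.mixedRow q (a 0) (a 2)).withTransportedTorus g g' hgg' hg'g hgΩ) q w₀ g g' 0 κ ^ (-(m + 3)) *
        weightAt' ((PlaneData.mixedRow q (a 0) (a 2)).withTransportedTorus g g' hgg' hg'g hgΩ) q w₀ g g' 1 κ ^ (-m) *
        d3Gen q a g g' hgg' hg'g hgΩ lam hiso w₀ m x := by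
  have hn0 := weightAt'_ne_zero_of_mem_torusT' q a g g' hgg' hg'g hgΩ lam hlam hiso w₀ hw hcm ha1 ha3 0 hκ
  rw [d3Gen_apply, d3Gen_apply, D3coeff'_torus'_mul q a g g' hgg' hg'g hgΩ lam hlam hiso w₀ hw hcm ha1 ha3 x κ hκ,
    detTwist_torus'_mul q a g g' hgg' hg'g hgΩ lam hlam hiso w₀ hw hcm ha1 ha3 m x κ hκ, neg_add, zpow_add₀ hn0,
    inv_pow, ← zpow_natCast, ← _root_.zpow_neg]
  push_cast
  ring

include hlam in
/-- **the LEFT `T′(𝔸)`-law of `d3Gen' p`**: `d3Gen' p (κ x) = u₀(κ)^{−p} u₁(κ)^{−(p + 3)} · d3Gen' p x`. -/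
theorem d3Gen'_torus'_mul (hw : w₀.IsReal) (hcm : IsCMAt q w₀) (ha1 : a 1 ≠ 0) (ha3 : a 3 ≠ 0) (p : ℤ)
    (x κ : GA ((PlaneData.mixedRow q (a 0) (a 2)).withTransportedTorus g g' hgg' hg'g hgΩ))
    (hκ : κ ∈ torusT' ((PlaneData.mixedRow q (a 0) (a 2)).withTransportedTorus g g' hgg' hg'g hgΩ)) :
    d3Gen' q a g g' hgg' hg'g hgΩ lam hiso w₀ p (κ * x) =
      weightAt' ((PlaneData.mixedRow q (a 0) (a 2)).withTransportedTorus g g' hgg' hg'g hgΩ) q w₀ g g' 0 κ ^ (-p) *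
        weightAt' ((PlaneData.mixedRow q (a 0) (a 2)).withTransportedTorus g g' hgg' hg'g hgΩ) q w₀ g g' 1 κ ^ (-(p + 3)) *
        d3Gen' q a g g' hgg' hg'g hgΩ lam hiso w₀ p x := by
  have hn1 := weightAt'_ne_zero_of_mem_torusT' q a g g' hgg' hg'g hgΩ lam hlam hiso w₀ hw hcm ha1 ha3 1 hκ
  rw [d3Gen'_apply, d3Gen'_apply, D3coeff''_torus'_mul q a g g' hgg' hg'g hgΩ lam hlam hiso w₀ hw hcm ha1 ha3 x κ hκ,
    detTwist_torus'_mul q a g g' hgg' hg'g hgΩ lam hlam hiso w₀ hw hcm ha1 ha3 p x κ hκ, neg_add, zpow_add₀ hn1,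
    inv_pow, ← zpow_natCast, ← _root_.zpow_neg]
  push_cast
  ring

include hlam in
/-- **the LEFT `T′(𝔸)`-law of the definite product**:
`defCoeffProd (κ x) = (∏_{w′ ≠ w₀} u₀(κ)_{w′}^{−eP′ w′} u₁(κ)_{w′}^{−eM′ w′}) · defCoeffProd x`. -/
theorem defCoeffProd_torus'_mul (hdef : ∀ w' : InfinitePlace k, w' ≠ w₀ → w'.IsReal ∧ IsCMAt q w')
    (ha1 : a 1 ≠ 0) (ha3 : a 3 ≠ 0)
    (x κ : GA ((PlaneData.mixedRow q (a 0) (a 2)).withTransportedTorus g g' hgg' hg'g hgΩ))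
    (hκ : κ ∈ torusT' ((PlaneData.mixedRow q (a 0) (a 2)).withTransportedTorus g g' hgg' hg'g hgΩ)) :
    defCoeffProd q a g g' hgg' hg'g hgΩ lam hiso w₀ eP' eM' (κ * x) =
      (∏ w' ∈ Finset.univ.erase w₀,
        (weightAt' ((PlaneData.mixedRow q (a 0) (a 2)).withTransportedTorus g g' hgg' hg'g hgΩ) q w' g g' 0 κ ^ (-eP' w') *
          weightAt' ((PlaneData.mixedRow q (a 0) (a 2)).withTransportedTorus g g' hgg' hg'g hgΩ) q w' g g' 1 κ ^ (-eM' w'))) *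
        defCoeffProd q a g g' hgg' hg'g hgΩ lam hiso w₀ eP' eM' x := by
  unfold defCoeffProd
  rw [← Finset.prod_mul_distrib]
  refine Finset.prod_congr rfl fun w' hw' => ?_
  obtain ⟨hr, hcm⟩ := hdef w' (Finset.ne_of_mem_erase hw')
  exact defCoeff_torus'_mul q a g g' hgg' hg'g hgΩ lam hlam hiso w' hr hcm ha1 ha3 _ _ x κ hκ

include hlam in
/-- **THE LEFT `T′(𝔸)`-LAW OF `archWitness`**: `archWitness (κ x) = Wt(κ) · archWitness x` (`he : eP′ w₀ = eM′ w₀ + 3`). -/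
theorem archWitness_torus'_mul (hw₀ : w₀.IsReal) (hcm₀ : IsCMAt q w₀) (ha1 : a 1 ≠ 0) (ha3 : a 3 ≠ 0)
    (hdef : ∀ w' : InfinitePlace k, w' ≠ w₀ → w'.IsReal ∧ IsCMAt q w') (he : eP' w₀ = eM' w₀ + 3)
    (x κ : GA ((PlaneData.mixedRow q (a 0) (a 2)).withTransportedTorus g g' hgg' hg'g hgΩ))
    (hκ : κ ∈ torusT' ((PlaneData.mixedRow q (a 0) (a 2)).withTransportedTorus g g' hgg' hg'g hgΩ)) :
    archWitness q a g g' hgg' hg'g hgΩ lam hiso w₀ eP' eM' (κ * x) =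
      torusWeight' q a g g' hgg' hg'g hgΩ eP' eM' κ * archWitness q a g g' hgg' hg'g hgΩ lam hiso w₀ eP' eM' x := by
  unfold archWitness torusWeight'
  rw [archProd_apply, archProd_apply, d3Gen_torus'_mul q a g g' hgg' hg'g hgΩ lam hlam hiso w₀ hw₀ hcm₀ ha1 ha3 _ x κ hκ,
    defCoeffProd_torus'_mul q a g g' hgg' hg'g hgΩ lam hlam hiso w₀ eP' eM' hdef ha1 ha3 x κ hκ,
    ← Finset.mul_prod_erase (Finset.univ : Finset (InfinitePlace k)) _ (Finset.mem_univ w₀), he]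
  ring

include hlam in
/-- **THE LEFT `T′(𝔸)`-LAW OF `archWitness'`**: `archWitness' (κ x) = Wt(κ) · archWitness' x` (`he : eM′ w₀ = eP′ w₀ + 3`). -/
theorem archWitness'_torus'_mul (hw₀ : w₀.IsReal) (hcm₀ : IsCMAt q w₀) (ha1 : a 1 ≠ 0) (ha3 : a 3 ≠ 0)
    (hdef : ∀ w' : InfinitePlace k, w' ≠ w₀ → w'.IsReal ∧ IsCMAt q w') (he : eM' w₀ = eP' w₀ + 3)
    (x κ : GA ((PlaneData.mixedRow q (a 0) (a 2)).withTransportedTorus g g' hgg' hg'g hgΩ))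
    (hκ : κ ∈ torusT' ((PlaneData.mixedRow q (a 0) (a 2)).withTransportedTorus g g' hgg' hg'g hgΩ)) :
    archWitness' q a g g' hgg' hg'g hgΩ lam hiso w₀ eP' eM' (κ * x) =
      torusWeight' q a g g' hgg' hg'g hgΩ eP' eM' κ * archWitness' q a g g' hgg' hg'g hgΩ lam hiso w₀ eP' eM' x := by
  unfold archWitness' torusWeight'
  rw [archProd_apply, archProd_apply, d3Gen'_torus'_mul q a g g' hgg' hg'g hgΩ lam hlam hiso w₀ hw₀ hcm₀ ha1 ha3 _ x κ hκ,
    defCoeffProd_torus'_mul q a g g' hgg' hg'g hgΩ lam hlam hiso w₀ eP' eM' hdef ha1 ha3 x κ hκ,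
    ← Finset.mul_prod_erase (Finset.univ : Finset (InfinitePlace k)) _ (Finset.mem_univ w₀), he]
  ring

include hlam in
/-- **THE LEFT `T′(𝔸)`-LAW OF THE BRANCH WITNESS**: `archWitnessOf (κ x) = Wt(κ) · archWitnessOf x`
(`he : eP′ w₀ = eM′ w₀ + 3 ∨ eM′ w₀ = eP′ w₀ + 3`, the case split of ArchMatchingSeesaw). -/
theorem archWitnessOf_torus'_mul (hw₀ : w₀.IsReal) (hcm₀ : IsCMAt q w₀) (ha1 : a 1 ≠ 0) (ha3 : a 3 ≠ 0)
    (hdef : ∀ w' : InfinitePlace k, w' ≠ w₀ → w'.IsReal ∧ IsCMAt q w')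
    (he : eP' w₀ = eM' w₀ + 3 ∨ eM' w₀ = eP' w₀ + 3)
    (x κ : GA ((PlaneData.mixedRow q (a 0) (a 2)).withTransportedTorus g g' hgg' hg'g hgΩ))
    (hκ : κ ∈ torusT' ((PlaneData.mixedRow q (a 0) (a 2)).withTransportedTorus g g' hgg' hg'g hgΩ)) :
    archWitnessOf q a g g' hgg' hg'g hgΩ lam hiso w₀ eP' eM' (κ * x) =
      torusWeight' q a g g' hgg' hg'g hgΩ eP' eM' κ * archWitnessOf q a g g' hgg' hg'g hgΩ lam hiso w₀ eP' eM' x := by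
  by_cases h : eP' w₀ = eM' w₀ + 3
  · rw [archWitnessOf_of_holo q a g g' hgg' hg'g hgΩ lam hiso w₀ eP' eM' h]
    exact archWitness_torus'_mul q a g g' hgg' hg'g hgΩ lam hlam hiso w₀ eP' eM' hw₀ hcm₀ ha1 ha3 hdef h x κ hκ
  · have h' : eM' w₀ = eP' w₀ + 3 := he.resolve_left h
    rw [archWitnessOf_of_anti q a g g' hgg' hg'g hgΩ lam hiso w₀ eP' eM' h]
    exact archWitness'_torus'_mul q a g g' hgg' hg'g hgΩ lam hlam hiso w₀ eP' eM' hw₀ hcm₀ ha1 ha3 hdef h' x κ hκ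

include hlam in
/-- **THE RIGHT `T′(𝔸)`-LAW OF THE BRANCH WITNESS**: `archWitnessOf (x κ) = Wt(κ) · archWitnessOf x`
(ArchFactorProd's `archWitness(')_mul_torus'` through the case split). -/
theorem archWitnessOf_mul_torus' (hw₀ : w₀.IsReal) (hcm₀ : IsCMAt q w₀) (ha1 : a 1 ≠ 0) (ha3 : a 3 ≠ 0)
    (hdef : ∀ w' : InfinitePlace k, w' ≠ w₀ → w'.IsReal ∧ IsCMAt q w')
    (he : eP' w₀ = eM' w₀ + 3 ∨ eM' w₀ = eP' w₀ + 3)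
    (x κ : GA ((PlaneData.mixedRow q (a 0) (a 2)).withTransportedTorus g g' hgg' hg'g hgΩ))
    (hκ : κ ∈ torusT' ((PlaneData.mixedRow q (a 0) (a 2)).withTransportedTorus g g' hgg' hg'g hgΩ)) :
    archWitnessOf q a g g' hgg' hg'g hgΩ lam hiso w₀ eP' eM' (x * κ) =
      torusWeight' q a g g' hgg' hg'g hgΩ eP' eM' κ * archWitnessOf q a g g' hgg' hg'g hgΩ lam hiso w₀ eP' eM' x := by
  by_cases h : eP' w₀ = eM' w₀ + 3
  · rw [archWitnessOf_of_holo q a g g' hgg' hg'g hgΩ lam hiso w₀ eP' eM' h]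
    exact archWitness_mul_torus' q a g g' hgg' hg'g hgΩ lam hlam hiso w₀ eP' eM' hw₀ hcm₀ ha1 ha3 hdef h x κ hκ
  · have h' : eM' w₀ = eP' w₀ + 3 := he.resolve_left h
    rw [archWitnessOf_of_anti q a g g' hgg' hg'g hgΩ lam hiso w₀ eP' eM' h]
    exact archWitness'_mul_torus' q a g g' hgg' hg'g hgΩ lam hlam hiso w₀ eP' eM' hw₀ hcm₀ ha1 ha3 hdef h' x κ hκ

end LeftLaws

section Pointwise

variable {k : Type} [Field k] [NumberField k] (q : QuadData k) (a : Fin 4 → k)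
  (g g' : Matrix (Fin 4) (Fin 4) k) (hgg' : g * g' = 1) (hg'g : g' * g = 1)
  (hgΩ : g * (PlaneData.mixedRow q (a 0) (a 2)).Ω = (PlaneData.mixedRow q (a 0) (a 2)).Ω * g)
  (lam : k) (hlam : lam ≠ 0)
  (hiso : g * (PlaneData.mixedRow q (a 1) (a 3)).B * gᵀ = lam • (PlaneData.mixedRow q (a 0) (a 2)).B)
  (w : InfinitePlace k)

/-- **`defCoeff w p m x ≠ 0 ↔ (p = 0 ∨ α′(x) ≠ 0) ∧ (m = 0 ∨ δ′(x) ≠ 0)`** — the diagonal entries of the `T′`-adapted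
`w`-block of `x`. -/
theorem defCoeff_ne_zero_iff (p m : ℤ)
    (x : GA ((PlaneData.mixedRow q (a 0) (a 2)).withTransportedTorus g g' hgg' hg'g hgΩ)) :
    defCoeff q a g g' hgg' hg'g hgΩ lam hiso w p m x ≠ 0 ↔
      (p = 0 ∨ locEntry' q a g g' hgg' hg'g hgΩ lam hiso w x 0 0 ≠ 0) ∧
        (m = 0 ∨ locEntry' q a g g' hgg' hg'g hgΩ lam hiso w x 1 1 ≠ 0) := by
  unfold defCoeff
  rw [mul_ne_zero_iff, wtMono_ne_zero_iff, wtMono_ne_zero_iff]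

/-- **`α′(x) ≠ 0` on `U(1,1)`** (the `w`-block of `T′` has signature `(1,1)`: `|α′| ≥ 1`, LocalUnitary's
`locEntry_zero_zero_ne_zero` at the conjugate). -/
theorem locEntry'_zero_zero_ne_zero (hw : w.IsReal) (hcm : IsCMAt q w)
    (ha1 : 0 < (adToC w (algebraMap k (Ad k) (a 1))).re) (ha3 : (adToC w (algebraMap k (Ad k) (-1 * a 3))).re < 0)
    (x : GA ((PlaneData.mixedRow q (a 0) (a 2)).withTransportedTorus g g' hgg' hg'g hgΩ)) :
    locEntry' q a g g' hgg' hg'g hgΩ lam hiso w x 0 0 ≠ 0 := by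
  unfold locEntry'
  exact locEntry_zero_zero_ne_zero q (a 1) (a 3) (-1) w hw hcm (disc_ne_zero_of_isCMAt q w hw hcm) ha1 ha3 _

/-- **the weight-3 coefficient never vanishes**: `D3coeff' x = α′(x)⁻¹ ^ 3 ≠ 0` on `U(1,1)`. -/
theorem D3coeff'_ne_zero (hw : w.IsReal) (hcm : IsCMAt q w)
    (ha1 : 0 < (adToC w (algebraMap k (Ad k) (a 1))).re) (ha3 : (adToC w (algebraMap k (Ad k) (-1 * a 3))).re < 0)
    (x : GA ((PlaneData.mixedRow q (a 0) (a 2)).withTransportedTorus g g' hgg' hg'g hgΩ)) :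
    D3coeff' q a g g' hgg' hg'g hgΩ lam hiso w x ≠ 0 := by
  rw [D3coeff'_eq]
  exact pow_ne_zero 3 (inv_ne_zero (locEntry'_zero_zero_ne_zero q a g g' hgg' hg'g hgΩ lam hiso w hw hcm ha1 ha3 x))

/-- **the antiholomorphic coefficient never vanishes**: `D3coeff'' x = δ′(x)⁻¹ ^ 3 ≠ 0` on `U(1,1)`
(`|δ′| ≥ 1`: LocalUnitary's `locEntry_one_one_ne_zero` at the conjugate). -/
theorem D3coeff''_ne_zero (hw : w.IsReal) (hcm : IsCMAt q w)
    (ha1 : 0 < (adToC w (algebraMap k (Ad k) (a 1))).re) (ha3 : (adToC w (algebraMap k (Ad k) (-1 * a 3))).re < 0)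
    (x : GA ((PlaneData.mixedRow q (a 0) (a 2)).withTransportedTorus g g' hgg' hg'g hgΩ)) :
    D3coeff'' q a g g' hgg' hg'g hgΩ lam hiso w x ≠ 0 := by
  rw [D3coeff''_eq]
  refine pow_ne_zero 3 (inv_ne_zero ?_)
  unfold locEntry'
  exact locEntry_one_one_ne_zero q (a 1) (a 3) (-1) w hw hcm ha1 ha3 _

/-- **the determinant twist never vanishes** (`|det| = 1` on the local unitary block). -/
theorem detTwist_ne_zero (hw : w.IsReal) (hcm : IsCMAt q w)
    (hA : adToC w (algebraMap k (Ad k) (a 1)) ≠ 0) (hB : adToC w (algebraMap k (Ad k) (-1 * a 3)) ≠ 0) (c : ℤ)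
    (x : GA ((PlaneData.mixedRow q (a 0) (a 2)).withTransportedTorus g g' hgg' hg'g hgΩ)) :
    detTwist q a g g' hgg' hg'g hgΩ lam hiso w c x ≠ 0 := by
  unfold detTwist
  refine (wtMono_ne_zero_iff c _).2 (Or.inr ?_)
  intro h0
  have h := norm_det_locMat'_eq_one q a g g' hgg' hg'g hgΩ lam hiso w hw hcm hA hB x
  rw [h0, norm_zero] at h
  exact zero_ne_one h

/-- the `w₀`-factor of the holomorphic branch never vanishes (`U(1,1)` signs at `w₀`). -/
theorem d3Gen_ne_zero (hw : w.IsReal) (hcm : IsCMAt q w)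
    (ha1 : 0 < (adToC w (algebraMap k (Ad k) (a 1))).re) (ha3 : (adToC w (algebraMap k (Ad k) (-1 * a 3))).re < 0)
    (m : ℤ) (x : GA ((PlaneData.mixedRow q (a 0) (a 2)).withTransportedTorus g g' hgg' hg'g hgΩ)) :
    d3Gen q a g g' hgg' hg'g hgΩ lam hiso w m x ≠ 0 := by
  have hA : adToC w (algebraMap k (Ad k) (a 1)) ≠ 0 := fun h => by rw [h, Complex.zero_re] at ha1; exact lt_irrefl _ ha1
  have hB : adToC w (algebraMap k (Ad k) (-1 * a 3)) ≠ 0 := fun h => by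
    rw [h, Complex.zero_re] at ha3; exact lt_irrefl _ ha3
  rw [d3Gen_apply]
  exact mul_ne_zero (D3coeff'_ne_zero q a g g' hgg' hg'g hgΩ lam hiso w hw hcm ha1 ha3 x)
    (detTwist_ne_zero q a g g' hgg' hg'g hgΩ lam hiso w hw hcm hA hB m x)

/-- the `w₀`-factor of the antiholomorphic branch never vanishes (`U(1,1)` signs at `w₀`). -/
theorem d3Gen'_ne_zero (hw : w.IsReal) (hcm : IsCMAt q w)
    (ha1 : 0 < (adToC w (algebraMap k (Ad k) (a 1))).re) (ha3 : (adToC w (algebraMap k (Ad k) (-1 * a 3))).re < 0)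
    (p : ℤ) (x : GA ((PlaneData.mixedRow q (a 0) (a 2)).withTransportedTorus g g' hgg' hg'g hgΩ)) :
    d3Gen' q a g g' hgg' hg'g hgΩ lam hiso w p x ≠ 0 := by
  have hA : adToC w (algebraMap k (Ad k) (a 1)) ≠ 0 := fun h => by rw [h, Complex.zero_re] at ha1; exact lt_irrefl _ ha1
  have hB : adToC w (algebraMap k (Ad k) (-1 * a 3)) ≠ 0 := fun h => by
    rw [h, Complex.zero_re] at ha3; exact lt_irrefl _ ha3
  rw [d3Gen'_apply]
  exact mul_ne_zero (D3coeff''_ne_zero q a g g' hgg' hg'g hgΩ lam hiso w hw hcm ha1 ha3 x)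
    (detTwist_ne_zero q a g g' hgg' hg'g hgΩ lam hiso w hw hcm hA hB p x)

variable (w₀ : InfinitePlace k) (eP' eM' : InfinitePlace k → ℤ)

/-- `defCoeffProd x ≠ 0 ↔ ∀ w′ ≠ w₀, defCoeff w′ (eP′ w′) (eM′ w′) x ≠ 0` (`Finset.prod_ne_zero_iff`). -/
theorem defCoeffProd_ne_zero_iff (x : GA ((PlaneData.mixedRow q (a 0) (a 2)).withTransportedTorus g g' hgg' hg'g hgΩ)) :
    defCoeffProd q a g g' hgg' hg'g hgΩ lam hiso w₀ eP' eM' x ≠ 0 ↔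
      ∀ w' ∈ Finset.univ.erase w₀, defCoeff q a g g' hgg' hg'g hgΩ lam hiso w' (eP' w') (eM' w') x ≠ 0 := by
  unfold defCoeffProd
  exact Finset.prod_ne_zero_iff

/-- **THE POINTWISE CRITERION**: with the `U(1,1)` signs at `w₀`, `archWitnessOf x ≠ 0 ↔ ∀ w′ ≠ w₀, defCoeff w′ (eP′ w′)
(eM′ w′) x ≠ 0` — the `w₀`-factor never vanishes, so the branch witness vanishes exactly where a definite-place factor
does (a diagonal entry of a `T′`-adapted definite block with a non-zero weight, `defCoeff_ne_zero_iff`). -/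
theorem archWitnessOf_ne_zero_iff (hw₀ : w₀.IsReal) (hcm₀ : IsCMAt q w₀)
    (ha1 : 0 < (adToC w₀ (algebraMap k (Ad k) (a 1))).re) (ha3 : (adToC w₀ (algebraMap k (Ad k) (-1 * a 3))).re < 0)
    (x : GA ((PlaneData.mixedRow q (a 0) (a 2)).withTransportedTorus g g' hgg' hg'g hgΩ)) :
    archWitnessOf q a g g' hgg' hg'g hgΩ lam hiso w₀ eP' eM' x ≠ 0 ↔
      ∀ w' ∈ Finset.univ.erase w₀, defCoeff q a g g' hgg' hg'g hgΩ lam hiso w' (eP' w') (eM' w') x ≠ 0 := by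
  rw [← defCoeffProd_ne_zero_iff q a g g' hgg' hg'g hgΩ lam hiso w₀ eP' eM' x]
  unfold archWitnessOf
  split_ifs with h
  · unfold archWitness
    rw [archProd_apply, mul_ne_zero_iff]
    exact and_iff_right (d3Gen_ne_zero q a g g' hgg' hg'g hgΩ lam hiso w₀ hw₀ hcm₀ ha1 ha3 _ x)
  · unfold archWitness'
    rw [archProd_apply, mul_ne_zero_iff]
    exact and_iff_right (d3Gen'_ne_zero q a g g' hgg' hg'g hgΩ lam hiso w₀ hw₀ hcm₀ ha1 ha3 _ x)

end Pointwise

end Summit.Ventures.HodgeRepro.Tier4.Line4
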